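import Literature.MathematicalPhysics.QuantumFieldTheory.Balaban1983to89.B12Cubes436

/-!
# `Balaban1983to89.B12Division35` — [Balaban1987RG1] (3.5) p. 271: the DIVISION of the `X`-sum of a cube `□` into
the far class «X∩(□̃²)ᶜ ≠ ∅» and the near class «X ⊂ □̃²» WITH BODY at print's regions on the site lattice, the
two subsums, and the two cases of the far class — PROVED (bookkeeping over the lineage's `MeetsZ` ∕ `B12Cubes436`)

HONEST FRAMING (cell `lit-balaban`, verbatim): statement-level skeleton of published theorems with citation tags;
proofs where landed; nothing here is a claim about the Yang–Mills mass gap.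

CITATION HEADER.  T. Bałaban, *Renormalization group approach to lattice gauge field theories. I. Generation of
effective actions in a small field approximation and a coupling constant renormalization in four dimensions*,
Commun. Math. Phys. **109** (1987) 249–301, doi:10.1007/bf01215223 [Balaban1987RG1] (cell paper B12 = «[I]»; held
text `paper:balaban1987-cmp109-rg-i-small-field`, journal page = PDF page + 248; p. 271 READ AS AN IMAGE from the
render `b2b-balaban-ref1/pages/1987-cmp109-rg-I-small-field/1987-cmp109-rg-I-small-field-p023-x2.png` by this seat,
2026-08-23).  Unit `lit-balaban-r09` gen 43 (reader/typer of B12, display owner of SKELETON row `B12.Eq3.5`, kind D;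
fold owner r20); HOME `run/shared/lean/pub/lit-balaban/`.

WHAT IS PRINTED (p. 271 [PDF 23], verbatim).  *«We consider now one term in the above sum, the term corresponding to a
cube □. Decomposing 𝐄^{(j)} according to (1.7), we obtain a sum of terms labeled by X ∈ 𝐃_j. We divide this sum into
two subsums, assigning a term to one of them according to a position of its localization domain X with respect to
□. The division is according to the conditions
  X∩(□̃²)ᶜ ≠ ∅,  or  X ⊂ □̃².   (3.5)
Consider a domain X satisfying the first condition above. Assume that X ∈ 𝐃_j. There are two cases possible, either
X∩□̃ = ∅, or X∩□̃ ≠ ∅. In the first case dist(X, □) ≥ M, the distance is in the scale η, hence in the scale ξ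
dist^{(ξ)}(X, □) ≥ M(Lʲη)⁻¹. In the second case X is a big domain in ξ-scale, for example d_j(X) ≥ (Lʲη)⁻¹. Thus
either the exponential decay of propagators corresponding to ξ-scale, or the exponential bound (1.18) should give a
small factor O((Lʲη)ᴺ) with an arbitrary power N, enough to control the sums.»*  (p. 257: «For a cube □ ∈ π_j and
n = 1, 2, … we define □̃ⁿ as a cube of the size (1 + 2n)M and with a center at the center of □.»)

WHAT THE TREE ALREADY HOLDS (used BY NAME; nothing restated).  The lattice lineage types localization domains of the
ξ-lattice as `B12Ext436Lattice.LDom d` (non-empty face-connected finite sets of `M`-blocks of sites of `ℤᵈ`, a block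
labelled by `B12Decay510Lattice.cubeOf M q`), the far class «X∩(□̃²)ᶜ ≠ ∅» as `B12Ext436Lattice.MeetsZ M Outer X`
(«some site of `Outer` lies in a cube of X») for an ABSTRACT far region, and `B12Cubes436` supplies PRINT'S REGIONS
on the site lattice — `□̃ⁿ = Metric.cthickening (n·R₀) □` (closed sup-neighbourhood, collar unit `R₀ = M(Lʲη)⁻¹`
sites) — with p. 271's two cases PROVED: `sep_sup` (first case: `x ∈ □`, `q ∈ (□̃²)ᶜ ⇒ 2R₀ ≤ dist_∞(x,q)`),
`lt_dist_of_not_mem_cthickening`, `treeLen_ge_of_meets` (second case, typed diameter currency `R₀ < M(d_j(X) + 3)`),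
and the far-class sum bound (4.36) `ineq436_box`.  SKELETON row `B12.Eq3.5` stayed `typed-existing` because the
DIVISION itself — the second class «X ⊂ □̃²», the fact that the two printed conditions are the two halves of ONE
dichotomy, and «We divide this sum into two subsums» — had no declaration at print's regions.

WHAT THIS FILE ADDS (kernel-checked; 0 `sorry`; no named `Prop` fact; the `def`s are predicates ∕ objects with bodies).
* §1 THE SECOND CLASS WITH BODY: `Inside M S X` («X ⊂ S»: every site of every cube of `X` lies in `S`), and the
  DICHOTOMY behind (3.5) for any region `S`: `not_meetsZ_compl_iff` (`¬(X∩Sᶜ ≠ ∅) ↔ X ⊂ S`), `meetsZ_compl_or_inside`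
  (exhaustive), `not_meetsZ_compl_and_inside` (exclusive).
* §2 (3.5) AT PRINT'S REGIONS: `FarClass M R₀ □ X := MeetsZ M (□̃²)ᶜ X` and `NearClass M R₀ □ X := Inside M (□̃²) X`
  with `□̃² = cthickening (2R₀) □` (`B12Cubes436`'s reading), `division35` (every `X` is in exactly one class),
  `nearClass_iff_not_farClass`.
* §3 «WE DIVIDE THIS SUM INTO TWO SUBSUMS»: `sum_division35` (any finite family of domains, any additive commutative
  monoid: `Σ_X f = Σ_{X far} f + Σ_{X near} f`) and `tsum_division35` (any summable real family over ALL domains: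
  `∑' X, f X = ∑'_{far} + ∑'_{near}` — the split in which (4.36) bounds the far subsum, `B12Cubes436.ineq436_box`).
* §4 THE TWO CASES OF THE FAR CLASS, BY NAME: `farClass_cases` — a far domain either has ALL its cube-sites outside
  `□̃` («X∩□̃ = ∅»; then `R₀ < dist_∞(x, q)` for `x ∈ □` and every cube-site `q` of `X`, `farClass_first_case`, i.e.
  «dist^{(ξ)}(X, □) ≥ M(Lʲη)⁻¹» up to the closed-neighbourhood convention) or meets `□̃` («X∩□̃ ≠ ∅»; then
  `R₀ < M(d_j(X) + 3)`, `farClass_second_case` = `B12Cubes436.treeLen_ge_of_meets`); and the separation of the whole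
  far region `farClass_sep` = `B12Cubes436.sep_sup`.

NOT CLAIMED.  The control sentence «Thus either the exponential decay of propagators corresponding to ξ-scale, or the
exponential bound (1.18) should give a small factor O((Lʲη)ᴺ) … enough to control the sums» is the content of rows
`B12.Eq3.9` ∕ `B12.Eq4.36` (`B12Cubes436.ineq436_box_printed`: the factor `exp(−(Lʲη)⁻¹)`), not of this file; the
site model of the lineage (ℤᵈ for the continuum torus T, cubes as `M`-blocks of sites, □̃ⁿ as closed
sup-neighbourhoods — DICTIONARY D-b03.14 ∕ D-b03.33 of `B12Cubes436`) is inherited unchanged; «for example d_j(X) ≥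
(Lʲη)⁻¹» is carried in the typed diameter currency of `treeLen_ge_of_meets` (`R₀ < M(d_j(X) + 3)`), as recorded
there.  Value = the (3.5) division itself as kernel objects at print's regions; NOT summit progress.
-/

namespace Literature.MathematicalPhysics.QuantumFieldTheory.Balaban1983to89.B12Division35

open Literature.MathematicalPhysics.QuantumFieldTheory.Balaban1983to89.B13ScaleTransfer (Pt)
open Literature.MathematicalPhysics.QuantumFieldTheory.Balaban1983to89.TreeLength (treeLen)
open Literature.MathematicalPhysics.QuantumFieldTheory.Balaban1983to89.B12Decay510Lattice (cubeOf)
open Literature.MathematicalPhysics.QuantumFieldTheory.Balaban1983to89.B12Ext436Lattice (LDom MeetsZ)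
open Literature.MathematicalPhysics.QuantumFieldTheory.Balaban1983to89.B12Cubes436
  (sep_sup lt_dist_of_not_mem_cthickening treeLen_ge_of_meets)
open Set Metric
open scoped BigOperators

variable {d : ℕ}

/-! ## §1. The second class «X ⊂ S» with body, and the dichotomy behind (3.5) -/

/-- **«X ⊂ □̃²»** (the second condition of (3.5)) for a region `S` of sites: every site of every cube of the
localization domain `X` lies in `S` (the lineage's domains are sets of `M`-blocks of sites, a block labelled by
`cubeOf M q`). [cite: Balaban1987RG1, (3.5) p.271] -/
def Inside (M : ℕ) (S : Set (Pt d)) (X : LDom d) : Prop :=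
  ∀ q : Pt d, cubeOf M q ∈ X.1 → q ∈ S

/-- unfolding of `Inside`. [cite: Balaban1987RG1, (3.5) p.271] -/
theorem inside_iff (M : ℕ) (S : Set (Pt d)) (X : LDom d) : Inside M S X ↔ ∀ q : Pt d, cubeOf M q ∈ X.1 → q ∈ S :=
  Iff.rfl

/-- THE DICHOTOMY: «X∩Sᶜ ≠ ∅» fails exactly when «X ⊂ S» — the two printed conditions of (3.5) are the two halves of
one alternative. [cite: Balaban1987RG1, (3.5) p.271] -/
theorem not_meetsZ_compl_iff (M : ℕ) (S : Set (Pt d)) (X : LDom d) : ¬ MeetsZ M Sᶜ X ↔ Inside M S X := by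
  simp only [MeetsZ, Inside, not_exists, not_and, mem_compl_iff, not_not]

/-- (3.5) is EXHAUSTIVE: every domain satisfies «X∩Sᶜ ≠ ∅» or «X ⊂ S». [cite: Balaban1987RG1, (3.5) p.271] -/
theorem meetsZ_compl_or_inside (M : ℕ) (S : Set (Pt d)) (X : LDom d) : MeetsZ M Sᶜ X ∨ Inside M S X := by
  rw [← not_meetsZ_compl_iff]
  exact em _

/-- (3.5) is EXCLUSIVE: no domain satisfies both conditions. [cite: Balaban1987RG1, (3.5) p.271] -/
theorem not_meetsZ_compl_and_inside (M : ℕ) (S : Set (Pt d)) (X : LDom d) : ¬ (MeetsZ M Sᶜ X ∧ Inside M S X) := by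
  rw [← not_meetsZ_compl_iff]
  exact fun h => h.2 h.1

/-- `Inside` is monotone in the region. [cite: Balaban1987RG1, (3.5) p.271] -/
theorem inside_mono {M : ℕ} {S S' : Set (Pt d)} (h : S ⊆ S') {X : LDom d} (hX : Inside M S X) : Inside M S' X :=
  fun q hq => h (hX q hq)

/-! ## §2. (3.5) at print's regions: `□̃² = cthickening (2R₀) □` -/

/-- **THE FAR CLASS «X∩(□̃²)ᶜ ≠ ∅» AT PRINT'S REGIONS**: `□̃²` = the closed sup-neighbourhood of radius `2R₀` of the
cube `□` (collar unit `R₀ = M(Lʲη)⁻¹` sites; p. 257 «□̃ⁿ … of the size (1 + 2n)M and with a center at the center of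
□», `B12Cubes436`'s reading) — the class over which (4.36) is summed (`B12Cubes436.ineq436_box`).
[cite: Balaban1987RG1, (3.5) p.271] -/
def FarClass (M : ℕ) (R₀ : ℝ) (B : Set (Pt d)) (X : LDom d) : Prop :=
  MeetsZ M (cthickening (2 * R₀) B)ᶜ X

/-- **THE NEAR CLASS «X ⊂ □̃²» AT PRINT'S REGIONS.** [cite: Balaban1987RG1, (3.5) p.271] -/
def NearClass (M : ℕ) (R₀ : ℝ) (B : Set (Pt d)) (X : LDom d) : Prop :=
  Inside M (cthickening (2 * R₀) B) X

/-- unfolding: the far class is the lineage's `MeetsZ` at `(□̃²)ᶜ`. [cite: Balaban1987RG1, (3.5) p.271] -/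
theorem farClass_iff (M : ℕ) (R₀ : ℝ) (B : Set (Pt d)) (X : LDom d) :
    FarClass M R₀ B X ↔ ∃ q : Pt d, cubeOf M q ∈ X.1 ∧ q ∉ cthickening (2 * R₀) B := Iff.rfl

/-- unfolding: the near class. [cite: Balaban1987RG1, (3.5) p.271] -/
theorem nearClass_iff (M : ℕ) (R₀ : ℝ) (B : Set (Pt d)) (X : LDom d) :
    NearClass M R₀ B X ↔ ∀ q : Pt d, cubeOf M q ∈ X.1 → q ∈ cthickening (2 * R₀) B := Iff.rfl

/-- «X ⊂ □̃²» ⟺ not «X∩(□̃²)ᶜ ≠ ∅». [cite: Balaban1987RG1, (3.5) p.271] -/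
theorem nearClass_iff_not_farClass (M : ℕ) (R₀ : ℝ) (B : Set (Pt d)) (X : LDom d) :
    NearClass M R₀ B X ↔ ¬ FarClass M R₀ B X :=
  (not_meetsZ_compl_iff M _ X).symm

/-- **(3.5), THE DIVISION**: every localization domain lies in exactly one of the two classes «X∩(□̃²)ᶜ ≠ ∅», «X ⊂ □̃²».
[cite: Balaban1987RG1, (3.5) p.271] -/
theorem division35 (M : ℕ) (R₀ : ℝ) (B : Set (Pt d)) (X : LDom d) :
    (FarClass M R₀ B X ∨ NearClass M R₀ B X) ∧ ¬ (FarClass M R₀ B X ∧ NearClass M R₀ B X) :=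
  ⟨meetsZ_compl_or_inside M _ X, not_meetsZ_compl_and_inside M _ X⟩

/-- the cube itself is in the near class's region: `□ ⊆ □̃²` (`R₀ ≥ 0`). [cite: Balaban1987RG1, p.257] -/
theorem box_subset_tilde2 {R₀ : ℝ} (hR₀ : 0 ≤ R₀) (B : Set (Pt d)) : B ⊆ cthickening (2 * R₀) B :=
  (self_subset_cthickening B).trans (cthickening_mono (by linarith) B)

/-! ## §3. «We divide this sum into two subsums» -/

open Classical in
/-- **THE TWO SUBSUMS, finite version**: for any finite family `𝒳` of localization domains and any summand,
`Σ_{X∈𝒳} f(X) = Σ_{X∈𝒳, X∩(□̃²)ᶜ≠∅} f(X) + Σ_{X∈𝒳, X⊂□̃²} f(X)`. [cite: Balaban1987RG1, (3.5) p.271] -/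
theorem sum_division35 {A : Type*} [AddCommMonoid A] (M : ℕ) (R₀ : ℝ) (B : Set (Pt d)) (𝒳 : Finset (LDom d))
    (f : LDom d → A) :
    ∑ X ∈ 𝒳, f X = ∑ X ∈ 𝒳.filter (FarClass M R₀ B), f X + ∑ X ∈ 𝒳.filter (NearClass M R₀ B), f X := by
  rw [← Finset.sum_filter_add_sum_filter_not 𝒳 (FarClass M R₀ B) f]
  congr 2
  exact Finset.filter_congr fun X _ => (nearClass_iff_not_farClass M R₀ B X).symm

/-- the near class is the complement of the far class as SETS of domains. [cite: Balaban1987RG1, (3.5) p.271] -/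
theorem setOf_nearClass_eq_compl (M : ℕ) (R₀ : ℝ) (B : Set (Pt d)) :
    {X : LDom d | NearClass M R₀ B X} = {X : LDom d | FarClass M R₀ B X}ᶜ := by
  ext X
  exact nearClass_iff_not_farClass M R₀ B X

/-- **THE TWO SUBSUMS, summable version** (the sum over ALL `X ∈ 𝐃_j` of (1.7), as in (4.36)–(4.37)): for a summable
real family, `∑' X, f(X) = ∑'_{X∩(□̃²)ᶜ≠∅} f(X) + ∑'_{X⊂□̃²} f(X)` — the first subsum is the one bounded by (4.36)
(`B12Cubes436.ineq436_box`). [cite: Balaban1987RG1, (3.5) p.271] -/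
theorem tsum_division35 (M : ℕ) (R₀ : ℝ) (B : Set (Pt d)) {f : LDom d → ℝ} (hf : Summable f) :
    ∑' X, f X = (∑' X : {X : LDom d // FarClass M R₀ B X}, f X.1)
      + ∑' X : {X : LDom d // NearClass M R₀ B X}, f X.1 := by
  have h := hf.tsum_subtype_add_tsum_subtype_compl {X : LDom d | FarClass M R₀ B X}
  rw [← setOf_nearClass_eq_compl] at h
  exact h.symm

/-! ## §4. The two cases of the far class (p. 271), by name from `B12Cubes436` -/

/-- **THE FAR REGION IS SEPARATED FROM THE CUBE** (p. 271 first case, sup reading): `x ∈ □`, `q ∈ (□̃²)ᶜ ⇒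
2R₀ ≤ dist_∞(x, q)` — `B12Cubes436.sep_sup`. [cite: Balaban1987RG1, (3.5) p.271] -/
theorem farClass_sep (R₀ : ℝ) (B : Set (Pt d)) : ∀ x ∈ B, ∀ q ∈ (cthickening (2 * R₀) B)ᶜ, 2 * R₀ ≤ dist x q :=
  sep_sup B (2 * R₀)

/-- **p. 271, THE TWO CASES** «either X∩□̃ = ∅, or X∩□̃ ≠ ∅» for a domain of the far class: either NO cube-site of `X`
lies in `□̃ = cthickening R₀ □`, or some cube-site does — and then (second case) `R₀ < M(d_j(X) + 3)` («X is a big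
domain in ξ-scale», `B12Cubes436.treeLen_ge_of_meets`, typed diameter currency). [cite: Balaban1987RG1, (3.5) p.271] -/
theorem farClass_cases {M : ℕ} (hM : 0 < M) {B : Set (Pt d)} (hB : B.Finite) {R₀ : ℝ} (hR₀ : 0 ≤ R₀) (X : LDom d)
    (hX : FarClass M R₀ B X) :
    (∀ q : Pt d, cubeOf M q ∈ X.1 → q ∉ cthickening R₀ B) ∨ R₀ < (M : ℝ) * (treeLen X.1 + 3) := by
  by_cases h : ∀ q : Pt d, cubeOf M q ∈ X.1 → q ∉ cthickening R₀ B
  · exact Or.inl h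
  · push Not at h
    obtain ⟨q₁, hq₁, hq₁'⟩ := h
    obtain ⟨q₂, hq₂, hq₂'⟩ := hX
    exact Or.inr (treeLen_ge_of_meets hM hB hR₀ X hq₁ hq₁' hq₂ hq₂')

/-- **p. 271, FIRST CASE** «X∩□̃ = ∅ … dist(X, □) ≥ M … hence in the scale ξ dist^{(ξ)}(X, □) ≥ M(Lʲη)⁻¹»: if no
cube-site of `X` lies in `□̃ = cthickening R₀ □`, then every cube-site of `X` is at sup-distance `> R₀` from every
site of `□` (closed-neighbourhood convention of `B12Cubes436`; `R₀ = M(Lʲη)⁻¹`). [cite: Balaban1987RG1, (3.5) p.271] -/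
theorem farClass_first_case {M : ℕ} {B : Set (Pt d)} {R₀ : ℝ} (X : LDom d)
    (h : ∀ q : Pt d, cubeOf M q ∈ X.1 → q ∉ cthickening R₀ B) {x : Pt d} (hx : x ∈ B) {q : Pt d}
    (hq : cubeOf M q ∈ X.1) : R₀ < dist x q :=
  lt_dist_of_not_mem_cthickening (h q hq) hx

/-- **p. 271, SECOND CASE** «X∩□̃ ≠ ∅ … X is a big domain in ξ-scale, for example d_j(X) ≥ (Lʲη)⁻¹» for a far domain,
in the typed currency: `R₀ < M(d_j(X) + 3)` — `B12Cubes436.treeLen_ge_of_meets`. [cite: Balaban1987RG1, (3.5) p.271] -/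
theorem farClass_second_case {M : ℕ} (hM : 0 < M) {B : Set (Pt d)} (hB : B.Finite) {R₀ : ℝ} (hR₀ : 0 ≤ R₀)
    (X : LDom d) (hX : FarClass M R₀ B X) {q₁ : Pt d} (h₁ : cubeOf M q₁ ∈ X.1) (h₁' : q₁ ∈ cthickening R₀ B) :
    R₀ < (M : ℝ) * (treeLen X.1 + 3) := by
  obtain ⟨q₂, hq₂, hq₂'⟩ := hX
  exact treeLen_ge_of_meets hM hB hR₀ X h₁ h₁' hq₂ hq₂'

end Literature.MathematicalPhysics.QuantumFieldTheory.Balaban1983to89.B12Division35
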